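import Summits.Langlands.Langlands.Theses.ExteriorSquareAscent
import Summits.Langlands.Langlands.Theses.HolomorphicShadow
import Literature.NumberTheory.Automorphic.ArchRankinSelbergAbsConvergenceProofs
import Literature.NumberTheory.Automorphic.ArchKirillovBoundGL2
import Literature.NumberTheory.Automorphic.PairLFunctionPolesRepDataHolds

/-!
# Line `Sketch` — crux `PairLPoleJS` (stmt-Langlands-19093), lead's skeleton (reshaped)

Crux: `Summit.Langlands.Langlands.Theses.ExteriorSquareAscent.PairLPoleJS` = Arthur–Clozel (2.3) /
Jacquet–Shalika II Prop. 3.6 for Borel–Jacquet data (definitionally the named fact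
`JacquetShalika1981_partialPairL_pole_repData`). Ranks `≤ 2` are theorems of the tree; in ranks `≥ 3`
every landed road funnels through the archimedean convergence `Ψ_∞(1; W, W̄, Φ) < ∞`
(`JacquetShalika1990_archRankinSelbergLIntegral_lt_top`), itself landed from Jacquet–Shalika's
Kirillov bound `JacquetShalika1981_archKirillovNorm_le m K` (`m + 1 ≥ 2`) by
`JacquetShalika1990_archRankinSelbergLIntegral_lt_top_of_archKirillovNorm_le_fact`; the rank-two case
`m = 1` is PROVED (`JacquetShalika1981_archKirillovNorm_le_one`, `ArchKirillovBoundGL2`).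

This skeleton cuts BELOW the Kirillov bound along the classification-free architecture the tree has
validated in rank two (Jacquet–Shalika I, §3, Prop. (3.8) and (3.16)):

* `stub_pContinuity` (JS I Prop. (3.8), first half, ranks `m + 1 ≥ 3`): a continuous `ψ_∞`-Whittaker
  functional on the Gårding space of an IRREDUCIBLE unitary representation of `GL_{m+1}(K_∞)` is
  continuous for the `U(𝔭_{m+1})`-seminorms (`𝔭` = matrices with vanishing last row) — the place where
  irreducibility (centre of `U(𝔤)` acting by scalars) enters;
* `stub_kirillovLe_of_pContinuous` (JS I Prop. (3.8), second half + (3.16), ranks `m + 1 ≥ 3`): for a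
  unitary representation and a `𝔭`-continuous Whittaker functional, the Kirillov integrals
  `∫ |ℓ(τ(diag(diag(u)k',1)) v)|² δ_{B_m}(u)⁻¹` are bounded by `c ‖v‖²` — the Mackey induction on the
  mirabolic tower `P_{m+1} = GL_m ⋉ K_∞^m ⊃ P_m ⊃ ⋯`;
* composition: the two stubs give `JacquetShalika1981_archKirillovNorm_le m K` for `m ≥ 2`
  (`archKirillovNorm_le_of_stubs`, with the landed ranks `m ≤ 1`), hence the archimedean convergence in
  every rank, hence the crux BY NAME (`PairLPoleJS_of`).
-/

noncomputable section

open MeasureTheory Measure NumberField NumberField.mixedEmbedding IsDedekindDomain Set Filter Topology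
open scoped MatrixGroups ENNReal NNReal Classical Matrix.Norms.Operator
-- `Classical`: the place subtypes indexing `mixedSpace K` are `Fintype` classically (`NormedCommRing (mixedSpace K)`)

-- the scoped `L∞`-operator normed ring structure on matrices (through which the Gårding calculus is set up)
set_option backward.isDefEq.respectTransparency false

set_option linter.dupNamespace false

namespace Summit.Langlands.Langlands.Cruxes.PairLPoleJS.Sketch

open Literature.NumberTheory.Automorphic

/-- **Stub (A): Jacquet–Shalika I, Prop. (3.8), first half, in ranks `m + 1 ≥ 3`.** For an irreducible
unitary strongly continuous representation `τ` of `GL_{m+1}(K_∞)` on a Hilbert space and a continuous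
`ψ_∞`-Whittaker functional `ℓ` on its Gårding space, `ℓ` is bounded by finitely many `U(𝔭)`-seminorms:
`‖ℓ v‖ ≤ C Σ_{w ∈ 𝒮'} ‖τ(w) v‖` with every letter `X` of every word `w ∈ 𝒮'` in
`𝔭 = {X | X (last) j = 0 ∀ j}` (the Lie algebra of the mirabolic `P_{m+1}`). Rank two (`m = 1`) is the
tree's `IsArchContWhittakerFunctional.norm_le_sum_pWords`. -/
theorem stub_pContinuity :
    ∀ (m : ℕ) (K : Type) [Field K] [NumberField K], 2 ≤ m →
      ∀ (hcpt : isCompact_glFiniteIntegralLevel (m + 1) K) (E : Type) [NormedAddCommGroup E]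
        [InnerProductSpace ℂ E] [CompleteSpace E]
        (τ : ContRepresentation ℂ (AutomorphyDatum.gl (m + 1) K hcpt).arch.carrier E)
        (hτ : τ.IsStronglyContinuous), τ.IsUnitary → τ.IsTopIrreducible →
      ∀ (ℓ : archGardingSpace hcpt τ →ₗ[ℂ] ℂ), IsArchContWhittakerFunctional hcpt τ hτ ℓ →
      ∃ (C : ℝ) (𝒮' : Finset (List (Matrix (Fin (m + 1)) (Fin (m + 1)) (mixedSpace K)))), 0 ≤ C ∧
        (∀ w ∈ 𝒮', ∀ X ∈ w, ∀ j, X (Fin.last m) j = 0) ∧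
        ∀ v : archGardingSpace hcpt τ, ‖ℓ v‖ ≤ C * ∑ w ∈ 𝒮', ‖archWordDerivE hcpt τ w (v : E)‖ := by
  sorry

/-- **Stub (B): the Kirillov bound for `𝔭`-continuous Whittaker functionals, ranks `m + 1 ≥ 3`**
(Jacquet–Shalika I, Prop. (3.8), second half, and (3.16) Proposition, p. 542): for a unitary strongly
continuous representation `τ` of `GL_{m+1}(K_∞)` on a Hilbert space and a `ψ_∞`-Whittaker functional
`ℓ` on its Gårding space that is bounded by `U(𝔭)`-seminorms, the Kirillov integrals of Gårding
vectors over `N_m \ GL_m` (Iwasawa coordinates `(u, k')`, weight `δ_{B_m}(u)⁻¹ = archTorusWeight m K 0 u`)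
are bounded by `c ‖v‖²` for a finite `c`, for all Haar measures. (Mackey induction on the mirabolic
tower; irreducibility is offered but should not be needed.) -/
theorem stub_kirillovLe_of_pContinuous :
    ∀ (m : ℕ) (K : Type) [Field K] [NumberField K], 2 ≤ m →
      ∀ (hcpt : isCompact_glFiniteIntegralLevel (m + 1) K) (E : Type) [NormedAddCommGroup E]
        [InnerProductSpace ℂ E] [CompleteSpace E]
        (τ : ContRepresentation ℂ (AutomorphyDatum.gl (m + 1) K hcpt).arch.carrier E)
        (hτ : τ.IsStronglyContinuous), τ.IsUnitary → τ.IsTopIrreducible →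
      ∀ (ℓ : archGardingSpace hcpt τ →ₗ[ℂ] ℂ), IsArchContWhittakerFunctional hcpt τ hτ ℓ →
      (∃ (C : ℝ) (𝒮' : Finset (List (Matrix (Fin (m + 1)) (Fin (m + 1)) (mixedSpace K)))), 0 ≤ C ∧
        (∀ w ∈ 𝒮', ∀ X ∈ w, ∀ j, X (Fin.last m) j = 0) ∧
        ∀ v : archGardingSpace hcpt τ, ‖ℓ v‖ ≤ C * ∑ w ∈ 𝒮', ‖archWordDerivE hcpt τ w (v : E)‖) →
      ∀ [MeasurableSpace (GL (Fin m) (mixedSpace K))] [BorelSpace (GL (Fin m) (mixedSpace K))]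
        [MeasurableSpace ((mixedSpace K)ˣ)] [BorelSpace ((mixedSpace K)ˣ)]
        (μ' : Measure (Fin m → (mixedSpace K)ˣ)), IsHaarMeasure μ' →
      ∀ (μK' : Measure ↥(Kinf m K)), IsHaarMeasure μK' →
      ∃ c : ℝ≥0∞, c ≠ ⊤ ∧ ∀ v : archGardingSpace hcpt τ,
        ∫⁻ p : (Fin m → (mixedSpace K)ˣ) × ↥(Kinf m K),
          ‖ℓ ⟨τ (toArch hcpt (GLn.cornerSucc (mixedSpace K)
              (glDiagonal m (mixedSpace K) p.1 * (p.2 : GL (Fin m) (mixedSpace K))))) (v : E),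
            apply_mem_archGardingSpace hτ _ v.2⟩‖ₑ ^ 2 *
            ENNReal.ofReal (archTorusWeight m K 0 p.1) ∂(μ'.prod μK') ≤ c * ‖(v : E)‖ₑ ^ 2 := by
  sorry

/-- **Composition, step 1: the Kirillov bound in every rank.** Ranks `m ≤ 1` are the landed
`JacquetShalika1981_archKirillovNorm_le_zero/_one`; ranks `m ≥ 2` are stub (A) fed into stub (B). -/
theorem archKirillovNorm_le_of_stubs (m : ℕ) (K : Type) [Field K] [NumberField K] :
    JacquetShalika1981_archKirillovNorm_le m K := by
  rcases m with _ | _ | m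
  · exact JacquetShalika1981_archKirillovNorm_le_zero K
  · exact JacquetShalika1981_archKirillovNorm_le_one K
  · intro _hm hcpt E _ _ _ τ hτ hτu hτi ℓ hℓ _ _ _ _ μ' hμ' μK' hμK'
    have hP := stub_pContinuity (m + 2) K (by omega) hcpt E τ hτ hτu hτi ℓ hℓ
    exact stub_kirillovLe_of_pContinuous (m + 2) K (by omega) hcpt E τ hτ hτu hτi ℓ hℓ hP μ' hμ' μK' hμK'

/-- **Composition, step 2: the crux BY NAME.** The Kirillov bound in every rank gives the archimedean
convergence `JacquetShalika1990_archRankinSelbergLIntegral_lt_top` in every rank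
(`…_of_archKirillovNorm_le_fact`), hence Arthur–Clozel (2.3) in its `L²` form in every rank
(`JacquetShalika1981_partialPairL_pole_of_eq_conj_of_archKirillovNorm_le_fact`), hence the Borel–Jacquet
form (`JacquetShalika1981_partialPairL_pole_repData_of_rank`), which is the crux definitionally. -/
theorem PairLPoleJS_of : Summit.Langlands.Langlands.Theses.ExteriorSquareAscent.PairLPoleJS :=
  JacquetShalika1981_partialPairL_pole_repData_of_rank fun _n F _ _ μ _ =>
    JacquetShalika1981_partialPairL_pole_of_eq_conj_of_archKirillovNorm_le_fact (μ := μ)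
      fun m => archKirillovNorm_le_of_stubs m F

/-- **The crux in the currency the skeleton checker keys on** (the shared item's first route,
`HolomorphicShadow`; all seven route copies of `PairLPoleJS` have the same body, so this is
`PairLPoleJS_of` up to unfolding). -/
theorem PairLPoleJS_proof : Summit.Langlands.Langlands.Theses.HolomorphicShadow.PairLPoleJS :=
  PairLPoleJS_of

end Summit.Langlands.Langlands.Cruxes.PairLPoleJS.Sketch

end
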